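import Mathlib
import Summits.KontsevichZagierPeriods.KontsevichZagierPeriods.Theses.TerasomaMultiplication

/-!
# Sketch — crux-ideate stmt-KontsevichZagierPeriods-3598 (MultiplicationThree), ideator 3, round 1

First lemmas of two idea cards, stated over existing declarations (no proofs required here):

* card `sector-convex-cobordism` — `JoinAvoidsDivisor`, `SectorBound`, `CentroidChart`,
  `CubeRootChart`;
* card `rank-one-period-injectivity` — `KoszulKernelRankOne`, `KoszulKernelIntegral`,
  `MultiplicationThreeIntegerExponent`.
-/

noncomputable section

open Complex Set

namespace Summit.KontsevichZagierPeriods.KontsevichZagierPeriods.Cruxes.MultiplicationThree.Ideator3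

/-- The primitive cube root of unity `ζ₃ = exp(2πi/3)`. -/
def ζ₃ : ℂ := Complex.exp (2 * Real.pi * Complex.I / 3)

/-- Terasoma's linear forms on the symmetric quotient `ℂ²_e = Sym²(𝔸¹_y)`:
`s_j(e₁,e₂) = 1 − ζ^j e₁ + ζ^{2j} e₂` (so that `s_j(y₁+y₂, y₁y₂) = (1 − ζ^j y₁)(1 − ζ^j y₂)` and
`s₀ s₁ s₂ = (1 − y₁³)(1 − y₂³)`, `s₀ + s₁ + s₂ = 3`). -/
def sLine (j : ℕ) (e₁ e₂ : ℂ) : ℂ := 1 - ζ₃ ^ j * e₁ + ζ₃ ^ (2 * j) * e₂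

/-- The open equilateral triangle `T` (centroid chart of the side-3 simplex:
`σ_j(z) = 1 − 2 Re(ζ^j z) > 0`). -/
def triangleT : Set ℂ :=
  {z | 0 < 1 - 2 * z.re ∧ 0 < 1 + z.re + Real.sqrt 3 * z.im ∧ 0 < 1 + z.re - Real.sqrt 3 * z.im}

/-- The symmetric image `ē(p)` of a point `(y₁,y₂) = (ζ^m u, ζ^{m'} v)` of a twisted quarter of the
bent square `P = (γ − ζγ) × (γ − ζ²γ)`. -/
def eBar (m m' : ℕ) (u v : ℝ) : ℂ × ℂ :=
  (ζ₃ ^ m * u + ζ₃ ^ m' * v, (ζ₃ ^ m * u) * (ζ₃ ^ m' * v))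

/-- Terasoma's positive triangle `Δ` in the e-plane: `q(z) = (z, −z̄)`. -/
def qMap (z : ℂ) : ℂ × ℂ := (z, -(starRingEnd ℂ z))

/-- **First lemma of card `sector-convex-cobordism` (the geometric heart).** The straight segment
in `ℂ²_e` from a point of (any μ₃-twisted quarter of) the bent square to a point of Terasoma's
triangle never meets the three lines `s_j = 0` before its endpoint: for `u, v, t ∈ [0,1)` and
`z ∈ T`, `s_j((1−t)·ē + t·q(z)) ≠ 0`. Reason: `s_j(ē) = (1 − ζ^{j+m}u)(1 − ζ^{j+m'}v)` has
`|arg| ≤ π/3`, `s_j(q z) = σ_j(z) > 0`, and the sector `{Re > 0}` is convex. -/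
def JoinAvoidsDivisor : Prop :=
  ∀ (m m' j : ℕ) (u v t : ℝ) (z : ℂ), u ∈ Ico (0:ℝ) 1 → v ∈ Ico (0:ℝ) 1 → t ∈ Ico (0:ℝ) 1 →
    z ∈ triangleT →
    sLine j ((1 - t) * (eBar m m' u v).1 + t * (qMap z).1)
            ((1 - t) * (eBar m m' u v).2 + t * (qMap z).2) ≠ 0

/-- Quantitative form: on the bent square every `s_j` lies in the closed sector `|arg| ≤ π/3`, and
along the join its real part stays positive (this also pins the branch of `(s₀s₁s₂)^{s−1}`
transported from `Δ` to `P̄` to the POSITIVE one, since `Σ_j arg s_j(ē) = 0`). -/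
def SectorBound : Prop :=
  (∀ (m m' j : ℕ) (u v : ℝ), u ∈ Icc (0:ℝ) 1 → v ∈ Icc (0:ℝ) 1 →
      |Complex.arg (sLine j (eBar m m' u v).1 (eBar m m' u v).2)| ≤ Real.pi / 3) ∧
  (∀ (m m' j : ℕ) (u v t : ℝ) (z : ℂ), u ∈ Ico (0:ℝ) 1 → v ∈ Ico (0:ℝ) 1 → t ∈ Ico (0:ℝ) 1 →
      z ∈ triangleT →
      0 < (sLine j ((1 - t) * (eBar m m' u v).1 + t * (qMap z).1)
                   ((1 - t) * (eBar m m' u v).2 + t * (qMap z).2)).re)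

/-- **`t = 1` face of the cobordism is the simplex representation** (one linear change of
variables, `|det| = 2√3`): the centroid chart `[T, 2√3·((1−2X)((1+X)²−3Y²))^{s−1}]` is
KZ-equivalent to the crux's simplex representation on `{σ₁,σ₂ > 0, σ₁+σ₂ < 3}`. Provable now. -/
def CentroidChart : Prop :=
  ∀ s : ℚ, 0 < s → ∀ (r r' : Literature.NumberTheory.Transcendental.KZ.IntegralRep 2),
    r.domain = {x | 0 < 1 - 2 * x 0 ∧ 0 < 1 + x 0 + Real.sqrt 3 * x 1 ∧ 0 < 1 + x 0 - Real.sqrt 3 * x 1} →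
    Set.EqOn r.integrand (fun x => 2 * Real.sqrt 3 *
      ((1 - 2 * x 0) * (1 + x 0 + Real.sqrt 3 * x 1) * (1 + x 0 - Real.sqrt 3 * x 1)) ^ ((s:ℝ) - 1)) r.domain →
    r'.domain = {x | 0 < x 0 ∧ 0 < x 1 ∧ x 0 + x 1 < 3} →
    Set.EqOn r'.integrand (fun x => (x 0 * x 1 * (3 - x 0 - x 1)) ^ ((s:ℝ) - 1)) r'.domain →
    Literature.NumberTheory.Transcendental.KZ.Equivalent r r'

/-- **`t = 0` faces land on the box** (cube-root chart, one change of variables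
`(v₁,v₂) = (u³,v³)`, `|det| = 9u²v²`): `[(0,1)², 9·v·((1−u³)(1−v³))^{s−1}]` is KZ-equivalent to the
crux's box representation. Provable now. (The four twisted quarters of the bent square contribute,
in the `ℤ[ζ₃]`-basis `{1, ζ}`, the integrands `(u−v)G, (−u−2v)G, (−u−2v)G, (−2u−v)G` on the
`1`-component — total `−3uG − 6vG ~ −9vG` by the swap `u ↔ v` — and `3(u−v)G ~ 0` on the
`ζ`-component.) -/
def CubeRootChart : Prop :=
  ∀ s : ℚ, 0 < s → ∀ (r r' : Literature.NumberTheory.Transcendental.KZ.IntegralRep 2),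
    r.domain = {x | ∀ i, x i ∈ Set.Ioo (0:ℝ) 1} →
    Set.EqOn r.integrand (fun x => 9 * x 1 *
      ((1 - x 0 ^ 3) * (1 - x 1 ^ 3)) ^ ((s:ℝ) - 1)) r.domain →
    r'.domain = {x | ∀ i, x i ∈ Set.Ioo (0:ℝ) 1} →
    Set.EqOn r'.integrand (fun x => (x 0) ^ (-(2:ℝ)/3) * (1 - x 0) ^ ((s:ℝ) - 1) *
      (x 1) ^ (-(1:ℝ)/3) * (1 - x 1) ^ ((s:ℝ) - 1)) r'.domain →
    Literature.NumberTheory.Transcendental.KZ.Equivalent r r'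

/-! ### Card `rank-one-period-injectivity` -/

/-- The twisted cellular boundary `∂₂` of the 2-skeleton of the 3-torus (Hattori: the complement
of three generic lines in `ℂ²` is homotopy equivalent to it) with all three monodromies equal to
`c = e^{2πis}`: faces `f₁₂, f₁₃, f₂₃ ↦ (1−c)(e_j − e_k)`. -/
def koszulMatrix (K : Type*) [CommRing K] (c : K) : Matrix (Fin 3) (Fin 3) K :=
  (1 - c) • !![1, 1, 0; -1, 0, 1; 0, -1, -1]

/-- **First lemma of card `rank-one-period-injectivity` (the algebra of "rank one").** Over a
field, for `c ≠ 1`, the kernel of the twisted boundary — i.e. `H₂((T³)⁽²⁾; L_c) ≅ H₂(U, L_s)` for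
the generic 3-line arrangement — is ONE-dimensional. -/
def KoszulKernelRankOne : Prop :=
  ∀ (K : Type) [Field K] (c : K), c ≠ 1 →
    Module.finrank K (LinearMap.ker (Matrix.toLin' (koszulMatrix K c))) = 1

/-- Integral refinement: over any commutative ring in which `1 − c` is a non-zero-divisor the
kernel is the free rank-one module spanned by `f₁₂ − f₁₃ + f₂₃` (no torsion in `H₂(U, L)` itself;
torsion can only enter through the comparison with locally-finite-at-`D` chains, annihilated by
powers of `1 − c`, a UNIT in `ℤ[ζ_N]` unless the order `N` of `c` is a prime power). -/
def KoszulKernelIntegral : Prop :=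
  ∀ (R : Type) [CommRing R] (c : R), (1 - c) ∈ nonZeroDivisors R →
    ∀ a : Fin 3 → R, (koszulMatrix R c).mulVec a = 0 ↔ ∃ t : R, a = t • ![1, -1, 1]

/-- The integer-exponent residue of the crux (trivial local system, outside the rank-one regime):
for `s = k ∈ ℕ_{>0}` both integrands unfold to polynomials after the cube-root chart and the two
representations reduce to the same rational number by Newton–Leibniz with MONOMIAL primitives.
Filed so that the rank-one line covers exactly `s ∉ ℤ`. -/
def MultiplicationThreeIntegerExponent : Prop :=
  ∀ k : ℕ, 0 < k → ∀ (r r' : Literature.NumberTheory.Transcendental.KZ.IntegralRep 2),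
    r.domain = {x | ∀ i, x i ∈ Set.Ioo (0:ℝ) 1} →
    Set.EqOn r.integrand (fun x => (x 0) ^ (-(2:ℝ)/3) * (1 - x 0) ^ ((k:ℝ) - 1) *
      (x 1) ^ (-(1:ℝ)/3) * (1 - x 1) ^ ((k:ℝ) - 1)) r.domain →
    r'.domain = {x | 0 < x 0 ∧ 0 < x 1 ∧ x 0 + x 1 < 3} →
    Set.EqOn r'.integrand (fun x => (x 0 * x 1 * (3 - x 0 - x 1)) ^ ((k:ℝ) - 1)) r'.domain →
    Literature.NumberTheory.Transcendental.KZ.Equivalent r r'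

/-- Sanity link: the integer-exponent item is literally the crux at `s = k`. -/
theorem integerExponent_of_crux
    (h : Summit.KontsevichZagierPeriods.KontsevichZagierPeriods.Theses.TerasomaMultiplication.MultiplicationThree) :
    MultiplicationThreeIntegerExponent := by
  intro k hk r r' hd hi hd' hi'
  have := h (k : ℚ) (by exact_mod_cast hk) r r' hd ?_ hd' ?_
  · exact this
  · intro x hx; simpa using hi hx
  · intro x hx; simpa using hi' hx

end Summit.KontsevichZagierPeriods.KontsevichZagierPeriods.Cruxes.MultiplicationThree.Ideator3
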